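import Mathlib.LinearAlgebra.Matrix.Permutation
import Mathlib.Combinatorics.Hall.Basic
import Mathlib.LinearAlgebra.Dimension.Constructions
import Mathlib.LinearAlgebra.Matrix.GeneralLinearGroup.Defs
import Mathlib.LinearAlgebra.Matrix.NonsingularInverse
import Mathlib.LinearAlgebra.Matrix.ToLin
import Mathlib.LinearAlgebra.GeneralLinearGroup.Basic
import Mathlib.Algebra.MvPolynomial.Funext
import Mathlib.RingTheory.MvPolynomial.Basic
import Mathlib.RingTheory.Adjoin.Basic
import Literature.Computability.AlgebraicComplexity.NonCommutativeRank
import Literature.Computability.AlgebraicComplexity.QuantumFunctionalsDegenerationProofs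
import HarnessLib

/-!
# Singular tuples of matrices is not a null cone; symmetries of `SING_{n,m}`
# (Makam–Wigderson 2021, §1.3: Theorems 1.8–1.16)

V. Makam, A. Wigderson, *Singular tuples of matrices is not a null cone (and the symmetries of
algebraic varieties)*, J. reine angew. Math. **780** (2021) 79–131 [MakamWigderson2021].
Displays transcribed from arXiv:1909.00857 (2019), §1.3 (held text `paper:arxiv-1909.00857`,
chunk locators `pNNNN:Lnn`); the journal version's numbering of Thms 1.8–1.16 / Def. 1.10 is
assumed identical (not independently checked — flag `lit want` if a reader finds a shift).
Typed literature for the cell `val-lit` (cross-ladder typing seat x3, row X3-MW21, rung V4 /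
N5 barrier side: the invariant-theory / null-cone NO-GO for `SING_{n,m}` = symbolic determinant
identity testing). Honest framing: VP ≠ VNP is NOT proved; nothing here bears on it; typed ≠
proved.

## Setting (§1.2, p0005) and dictionary

`Mat_n^m = ℂ^m ⊗ ℂ^n ⊗ ℂ^n` is `MakamWigderson.Tuple n m = Fin m → Matrix (Fin n) (Fin n) ℂ`,
`GL(V)` is Mathlib's `LinearMap.GeneralLinearGroup ℂ (Tuple n m)` (invertible linear maps).

* `SING_{n,m} = {X | ∑ᵢ tᵢ Xᵢ singular over ℂ(t₁,…,t_m)}` (p0005:L4) → `MakamWigderson.SING`: the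
  symbolic matrix `∑ᵢ tᵢ Xᵢ` over `ℂ[t]` (`pencil`) has determinant `0`; "the zero locus of all
  polynomials `{det(c₁X₁ + ⋯ + c_mX_m) : cᵢ ∈ ℂ}`" (p0005:L7) is PROVED equivalent
  (`mem_SING_iff_forall_det_eq_zero`).
* `NSING_{n,m}` (p0005:L16; singular over the free skew field) → `MakamWigderson.NSING`, typed in
  the SHRUNK-SUBSPACE form `ncrk{X₁,…,X_m} < n` over the tree's `ncRank`
  (`NonCommutativeRank.lean`; the identification with the free-skew-field rank [FR04, Thm 1]
  (Cohn) is the one the paper uses via [GGOW16, IQS] and is NOT formalized in the tree — said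
  there and here). PROVED: `NSING ⊆ SING` (`NSING_subset_SING`, via `rank_le_ncRank`).
  (The tree's `IsUnstable`, `Barriers/MatrixMultiplication/UnstableTensorBarrier.lean`, is the null
  cone of `SL × SL × SL` on ALL three factors — a different, larger-group notion; `NSING` is the null
  cone of the left-right `SL_n × SL_n` action, p0005:L21, not re-typed as such.)
* Def. 1.10 group of symmetries `𝒢_S = {g ∈ GL(V) | gS = S}` (p0006:L8) → `symmetryGroup S`;
  the identity component `𝒢_S°` is not typed (no Zariski identity component in the tree).
* `G_{n,m}` = image of `GL_m × GL_n × GL_n → GL(Mat_n^m)`,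
  `(P,Q,R)·X = (∑ⱼ p_{ij} Q Xⱼ R⁻¹)ᵢ` (p0006:L14–18) → `tripleActHom`, `G n m` (its range); the
  linear map is the tree's 3-tensor action `actTensor P Q (R⁻¹)ᵀ` (`QuantumFunctionals.lean`),
  `tripleAct_apply_eq_sum` PROVES the printed formula.
* `τ : X ↦ (X₁ᵀ,…,X_mᵀ)` (Thm. 1.13) → `tau`; coordinate subspaces `L_I`, `I ⊆ [m]×[n]×[n]`
  (Def. 10.4, p0026:L31; Def. 2.9) → `coordSubspace I`; `π_{2,3}` → `proj23`; "contains a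
  permutation / permutation free" (p0026:L42) → `ContainsPerm`.

## Coverage (source item → declaration → status), faithfulness sheet

* Problems 1.2, 1.4, 1.5, 1.6 (p0003:L27–p0004:L22: "Given a subvariety `S ⊆ V`, is it the null
  cone for the (algebraic) action of a (reductive) group `G` on `V`?", "compute `𝒢_S`",
  "compute `𝒢_S°`", "is `ℂ[{fᵢ}]` an invariant ring?") — QUESTIONS, docstring only.
* **Thm. 1.8** (p0005:L35, verbatim): "Let `n, m ≥ 3`. Let `G` be any reductive group acting
  algebraically on `Mat_n^m` by linear transformations. Then the null cone for the action of `G`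
  is not equal to `SING_{n,m}`." **Thm. 1.9** (p0006:L1, verbatim): "Let `G` be any reductive group
  acting algebraically on `V = Mat_n^m` by linear transformations which preserve `SING_{n,m}` …
  If the null cone `𝒩 ⊆ SING_{n,m}`, then the null cone `𝒩 ⊆ NSING_{n,m}`." Mathlib has no
  reductive algebraic groups and no Hilbert–Mumford criterion (Thm. 2.11, p0010:L13: `𝒩_G(V) =
  G · 𝒩_T(V)`, and `𝒩_T` = a union of coordinate subspaces in a weight basis, Prop. 2.10); the
  typed `_core` declarations are the statements the printed proof (§10.2, p0026:L69–p0027) reduces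
  1.8/1.9 to AFTER Hilbert–Mumford and conjugation of a maximal torus into `T_{n,m}`:
  `makamWigderson2021_thm_1_9_core` (every symmetry of `SING` maps every coordinate subspace
  contained in `SING` into `NSING`) and `makamWigderson2021_thm_1_8_core` (`n, m ≥ 3`: no union of
  such translates under a subgroup of `𝒢_{SING}` equals `SING`) — FACTS, WEAKER-BY-DESIGN than
  1.8/1.9 (no fake generality); PROVED reductions `makamWigderson2021_thm_1_9_core_of` (from the
  typed Thms 1.13/1.14 and the proved Cor. 10.7) and `makamWigderson2021_thm_1_8_core_of`, and the
  BY-NAME forms `makamWigderson2021_thm_1_9_core_of_thm_1_13_of_thm_1_14 : thm_1_13 → thm_1_14 →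
  thm_1_9_core` (degenerate sizes handled) and `makamWigderson2021_thm_1_8_core_of_thm_1_13_of_thm_1_14`.
* Def. 1.10 (p0006:L8) → `symmetryGroup` DEF (+ `mem_symmetryGroup_iff`). **Thm. 1.11**
  (p0006:L25: `𝒢°_{SING} = G_{n,m}`) — NOT TYPED (identity component), docstring only.
* **Thm. 1.12 (Frobenius)** (p0006:L30): "`𝒢_S` consists of linear transformations of the form
  `X ↦ PXQ` or of the form `X ↦ PXᵗQ` where `P, Q ∈ SL_n`" → `makamWigderson2021_thm_1_12`, typed as
  the `m = 1` instance of Thm. 1.13 (`𝒢_{SING_{n,1}} = G_{n,1} ∪ G_{n,1}·τ`, i.e. `P, Q ∈ GL_n`, the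
  paper's own §6 reading p0015:L5 "`X ↦ PXQᵗ`, `(P,Q) ∈ GL_n × GL_n` … is the group `G_{n,1}`") —
  ERRATUM-NOTED: with "`SL_n`" literally the sentence is false for `n ≥ 1` (`X ↦ 2X` preserves
  `S` and scales `det` by `2ⁿ`), so the printed "`SL_n`" is a slip for "`GL_n`" [Frobenius 1897;
  Dieudonné 1949]; reported to the cell's errata desk. The tree's
  `Literature.NumberTheory.DiophantineGeometry.frobenius_detPreserver_unimodular_sandwich` is the
  DETERMINANT-preserver form (`det ∘ g = det`), a different statement; not restated.
* **Thm. 1.13** (p0006:L35: `𝒢_{SING_{n,m}} = G_{n,m} ∪ G_{n,m}·τ = G_{n,m} ⋊ ℤ/2`) →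
  `makamWigderson2021_thm_1_13` FACT — FAITHFUL (membership form: `g ∈ 𝒢_S ↔ g ∈ G ∨ g τ ∈ G`,
  `τ² = 1`; the semidirect-product structure is not typed); its easy inclusion `⊇` is PROVED
  (`G_le_symmetryGroup_SING`, `tau_mem_symmetryGroup_SING`, `mem_symmetryGroup_SING_of_mem_G_or`),
  a sanity check of the typed vocabulary.
* **Thm. 1.14** (p0006:L40: same for `NSING`) → `makamWigderson2021_thm_1_14` FACT — FAITHFUL; the
  part `G_{n,m} ≤ 𝒢_{NSING}` of its easy inclusion is PROVED (`G_le_symmetryGroup_NSING`, via the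
  invariance of the tree's `ncRank` under invertible left/right multiplication,
  `ncRank_image_mul_left/right`, and under the change of spanning set, `span_range_tripleAct`);
  `τ ∈ 𝒢_{NSING}` (transpose invariance of the non-commutative rank) is not proved here.
* Rem. 1.15 (p0006:L45: all results hold over every algebraically closed field of every
  characteristic, App. 15) — docstring only; typed over `ℂ` as printed in §1.
* **Thm. 1.16** (p0007:L3): "Suppose `n, m ≥ 3`. Then the subring
  `R = ℂ[{det(∑ᵢ cᵢ Xᵢ) : cᵢ ∈ ℂ}] ⊆ ℂ[Mat_n^m]` is not the invariant ring for any linear action of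
  any group `G` on `Mat_n^m`" → `makamWigderson2021_thm_1_16` FACT — FAITHFUL (a linear action is a
  homomorphism `ρ : Γ →* GL(V)`; the invariant ring `ℂ[V]^Γ` is `invariantSubalgebra ρ`, polynomial
  FUNCTIONS on `V` being identified with `MvPolynomial (Fin m × Fin n × Fin n) ℂ`, legitimate over
  the infinite field `ℂ`; `R` is `Algebra.adjoin ℂ (range detPencilPoly)`).
* §10 (p0026): Def. 10.1/10.2/10.4 → `coordSubspace`, `proj23`; **Prop. 10.6** (`L_I ⊆ SING ↔
  π_{2,3}(I)` permutation free) **PROVED** (`coordSubspace_subset_SING_iff`); **Prop. 10.5** (`L_I ⊆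
  NSING ↔ π_{2,3}(I)` permutation free) **PROVED** (`coordSubspace_subset_NSING_iff`; `←` by Hall's
  marriage theorem on the support pattern and the tree's cover bound `ncRank_le_of_cover`);
  **Cor. 10.7 PROVED** (`coordSubspace_subset_NSING_iff_subset_SING`); the
  `n = m = 3` example `X ∈ SING_{3,3} ∖ NSING_{3,3}` (p0027: the basis of `𝔰𝔬₃`) → `skewTriple`,
  `skewTriple_mem_SING` PROVED and `skewTriple_not_mem_NSING` PROVED (a full-rank square
  `2`-blow-up certificate `∑ᵢ Xᵢ ⊗ Tᵢ` with an explicit integer inverse, via the tree's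
  `ncRank_eq_card_of_mem_blowUp`, [DM18, Cor 4.7]), whence `NSING_ssubset_SING_three :
  NSING 3 3 ⊂ SING 3 3` PROVED; the general statement "`NSING_{n,m} ⊊ SING_{n,m}` precisely when
  `n, m ≥ 3`" (p0027; [FR04], [DM18]) is the FACT `makamWigderson2021_sec10_properSubset` (its
  middle conjunct is now the theorem `skewTriple_not_mem_NSING`).

## References

* V. Makam, A. Wigderson, J. reine angew. Math. 780 (2021) 79–131 = arXiv:1909.00857.
  [MakamWigderson2021]
* M. Fortin, C. Reutenauer, *Commutative/noncommutative rank of linear matrices and subspaces of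
  matrices of low rank*, Sém. Lothar. Combin. 52 (2004) B52f (MW's [FR]). [FortinReutenauer2004]
* M. Bläser, G. Jindal, A. Pandey, Theory of Computing 14 (2018) (shrunk subspaces, the tree's
  `ncRank`). [BlaeserJindalPandey2018]

## Tree

`ncRank`, `ncRank_span`, `rank_le_ncRank` (`NonCommutativeRank`); `actTensor`, `actTensor_apply`,
`actTensor_one`, `actTensor_actTensor` (`QuantumFunctionals`, `QuantumFunctionalsDegenerationProofs`);
Mathlib `LinearMap.GeneralLinearGroup`, `MonoidHom.toHomUnits`, `Equiv.Perm.permMatrix`,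
`Matrix.det_permutation`, `Matrix.rank_of_isUnit`, `MvPolynomial.funext`, `RingHom.map_det`;
`blowUp`, `ncRank_eq_card_of_mem_blowUp` (`NonCommutativeRank`, the blow-up certificate).
-/

noncomputable section

open MvPolynomial Matrix

namespace Literature.Computability.AlgebraicComplexity

namespace MakamWigderson

/-! ### The space `Mat_n^m`, `SING`, `NSING` -/

/-- `V = Mat_n^m`: `m`-tuples of complex `n × n` matrices (MW §1.2, p0005:L1–4).
[cite: MakamWigderson2021, §1.2] -/
abbrev Tuple (n m : ℕ) : Type := Fin m → Matrix (Fin n) (Fin n) ℂ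

variable {n m : ℕ}

/-- The symbolic matrix `∑ᵢ tᵢ Xᵢ` over `ℂ[t₁, …, t_m]` (MW §1.2, p0005:L4).
[cite: MakamWigderson2021, §1.2 (1)] -/
def pencil (X : Tuple n m) : Matrix (Fin n) (Fin n) (MvPolynomial (Fin m) ℂ) :=
  ∑ i, (MvPolynomial.X i : MvPolynomial (Fin m) ℂ) • (X i).map MvPolynomial.C

/-- **`SING_{n,m}`** = "`{X = (X₁,…,X_m) ∈ Mat_n^m | ∑ᵢ tᵢ Xᵢ singular (over ℂ(t₁,…,t_m))}`"
(MW §1.2 (1), p0005:L4): the symbolic determinant `det(∑ᵢ tᵢ Xᵢ) ∈ ℂ[t]` vanishes identically.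
[cite: MakamWigderson2021, §1.2 (1)] -/
def SING (n m : ℕ) : Set (Tuple n m) :=
  {X | (pencil X).det = 0}

/-- **`NSING_{n,m}`** = "`{X ∈ Mat_n^m | ∑ᵢ tᵢ Xᵢ singular over the free skew field ℂ⦓t₁,…,t_m⦔}`"
(MW §1.2, p0005:L16), typed in the shrunk-subspace form: the non-commutative rank of the matrix
space spanned by `X₁, …, X_m` (the tree's `ncRank`, [BJP18, Def 2.5]; = rank over the free skew
field by [FR04, Thm 1], an identification NOT formalized in the tree) is `< n`.
[cite: MakamWigderson2021, §1.2 (NSING)] -/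
def NSING (n m : ℕ) : Set (Tuple n m) :=
  {X | ncRank (Set.range X) < n}

/-- Unfolding `SING`. [cite: MakamWigderson2021, §1.2 (1)] -/
theorem mem_SING_iff (X : Tuple n m) : X ∈ SING n m ↔ (pencil X).det = 0 := Iff.rfl

/-- Unfolding `NSING`. [cite: MakamWigderson2021, §1.2 (NSING)] -/
theorem mem_NSING_iff (X : Tuple n m) : X ∈ NSING n m ↔ ncRank (Set.range X) < n := Iff.rfl

/-- Evaluating the symbolic matrix `∑ᵢ tᵢ Xᵢ` at `t = c` gives `∑ᵢ cᵢ Xᵢ`.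
[cite: MakamWigderson2021, §1.2 (p0005:L7)] -/
theorem pencil_map_eval (X : Tuple n m) (c : Fin m → ℂ) :
    (pencil X).map (MvPolynomial.eval c) = ∑ i, c i • X i := by
  ext a b
  simp only [pencil, Matrix.map_apply, Matrix.sum_apply, Matrix.smul_apply, smul_eq_mul, map_sum,
    map_mul, MvPolynomial.eval_X, MvPolynomial.eval_C]

/-- **`SING_{n,m}` is "the zero locus of all polynomials `{det(c₁X₁ + c₂X₂ + ⋯ + c_mX_m) : cᵢ ∈ ℂ}`"**
(MW §1.2, p0005:L7): `det(∑ tᵢXᵢ) = 0` in `ℂ[t]` iff `det(∑ cᵢXᵢ) = 0` for all `c ∈ ℂ^m` (a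
polynomial over the infinite field `ℂ` vanishes iff it vanishes at every point).
[cite: MakamWigderson2021, §1.2 (p0005:L7)] -/
theorem mem_SING_iff_forall_det_eq_zero (X : Tuple n m) :
    X ∈ SING n m ↔ ∀ c : Fin m → ℂ, (∑ i, c i • X i).det = 0 := by
  have key : ∀ c : Fin m → ℂ, MvPolynomial.eval c (pencil X).det = (∑ i, c i • X i).det := by
    intro c
    rw [RingHom.map_det, RingHom.mapMatrix_apply, pencil_map_eval]
  refine ⟨fun h c => by rw [← key c, (mem_SING_iff X).mp h, map_zero], fun h => ?_⟩
  exact MvPolynomial.funext fun c => by rw [key c, h c, map_zero]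

/-- **`NSING_{n,m} ⊆ SING_{n,m}`** (MW §1.2; p0027: "`NSING_{n,m} ⊆ SING_{n,m}`"): every member
`∑ cᵢXᵢ` of the matrix space has rank `≤ ncrk` ([BJP18, Lemma 2.6], the tree's `rank_le_ncRank`),
so it is singular when `ncrk < n`. [cite: MakamWigderson2021, §10 (p0027, NSING ⊆ SING)] -/
theorem NSING_subset_SING : NSING n m ⊆ SING n m := by
  intro X hX
  rw [mem_NSING_iff] at hX
  rw [mem_SING_iff_forall_det_eq_zero]
  intro c
  set B : Matrix (Fin n) (Fin n) ℂ := ∑ i, c i • X i with hB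
  have hBmem : B ∈ (Submodule.span ℂ (Set.range X) : Set (Matrix (Fin n) (Fin n) ℂ)) := by
    refine Submodule.sum_mem _ fun i _ => Submodule.smul_mem _ _ (Submodule.subset_span ⟨i, rfl⟩)
  have hrk : B.rank < n := by
    have h1 := rank_le_ncRank (F := ℂ) hBmem
    rw [ncRank_span] at h1
    exact lt_of_le_of_lt h1 hX
  by_contra hdet
  have hunit : IsUnit B := (Matrix.isUnit_iff_isUnit_det B).mpr (isUnit_iff_ne_zero.mpr hdet)
  have := Matrix.rank_of_isUnit B hunit
  rw [Fintype.card_fin] at this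
  omega

/-! ### Def. 1.10: the group of symmetries; `G_{n,m}` and `τ` -/

section Symmetry

variable {V : Type*} [AddCommGroup V] [Module ℂ V]

/-- **MW Def. 1.10 (group of symmetries)** (p0006:L8): for a subset `S ⊆ V`,
`𝒢_S = {g ∈ GL(V) | gS = S}` ("always an algebraic subgroup of `GL(V)`"). Here `GL(V)` is Mathlib's
group of invertible linear maps `LinearMap.GeneralLinearGroup ℂ V`.
[cite: MakamWigderson2021, Def. 1.10] -/
def symmetryGroup (S : Set V) : Subgroup (LinearMap.GeneralLinearGroup ℂ V) where
  carrier := {g | (fun v => (g : V →ₗ[ℂ] V) v) '' S = S}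
  one_mem' := by
    show (fun v => ((1 : LinearMap.GeneralLinearGroup ℂ V) : V →ₗ[ℂ] V) v) '' S = S
    simp
  mul_mem' := by
    intro g h hg hh
    change (fun v => ((g * h : LinearMap.GeneralLinearGroup ℂ V) : V →ₗ[ℂ] V) v) '' S = S
    have : (fun v => ((g * h : LinearMap.GeneralLinearGroup ℂ V) : V →ₗ[ℂ] V) v) =
        (fun v => (g : V →ₗ[ℂ] V) v) ∘ (fun v => (h : V →ₗ[ℂ] V) v) := rfl
    rw [this, Set.image_comp, hh, hg]
  inv_mem' := by
    intro g hg
    change (fun v => ((g⁻¹ : LinearMap.GeneralLinearGroup ℂ V) : V →ₗ[ℂ] V) v) '' S = S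
    have hinv : ∀ v, ((g⁻¹ : LinearMap.GeneralLinearGroup ℂ V) : V →ₗ[ℂ] V)
        ((g : V →ₗ[ℂ] V) v) = v := fun v => by
      rw [← Module.End.mul_apply, ← Units.val_mul, inv_mul_cancel, Units.val_one,
        Module.End.one_apply]
    have hinv' : ∀ v, (g : V →ₗ[ℂ] V)
        (((g⁻¹ : LinearMap.GeneralLinearGroup ℂ V) : V →ₗ[ℂ] V) v) = v := fun v => by
      rw [← Module.End.mul_apply, ← Units.val_mul, mul_inv_cancel, Units.val_one,
        Module.End.one_apply]
    ext w
    constructor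
    · rintro ⟨v, hv, rfl⟩
      have : (g : V →ₗ[ℂ] V) (((g⁻¹ : LinearMap.GeneralLinearGroup ℂ V) : V →ₗ[ℂ] V) v) ∈ S := by
        rw [hinv']; exact hv
      rw [← hg] at this
      obtain ⟨u, hu, hgu⟩ := this
      have huv : u = ((g⁻¹ : LinearMap.GeneralLinearGroup ℂ V) : V →ₗ[ℂ] V) v := by
        have := congrArg (fun x => ((g⁻¹ : LinearMap.GeneralLinearGroup ℂ V) : V →ₗ[ℂ] V) x) hgu
        simpa only [hinv] using this
      show ((g⁻¹ : LinearMap.GeneralLinearGroup ℂ V) : V →ₗ[ℂ] V) v ∈ S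
      rw [← huv]; exact hu
    · intro hw
      refine ⟨(g : V →ₗ[ℂ] V) w, ?_, hinv w⟩
      rw [← hg]
      exact ⟨w, hw, rfl⟩

/-- Membership in `𝒢_S`: `gS = S`. [cite: MakamWigderson2021, Def. 1.10] -/
theorem mem_symmetryGroup_iff (S : Set V) (g : LinearMap.GeneralLinearGroup ℂ V) :
    g ∈ symmetryGroup S ↔ (fun v => (g : V →ₗ[ℂ] V) v) '' S = S := Iff.rfl

end Symmetry

/-- The linear map `X ↦ (∑ⱼ p_{ij} Q Xⱼ Cᵀ)ᵢ` of `Mat_n^m = ℂ^m ⊗ ℂ^n ⊗ ℂ^n`, i.e. the tree's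
3-tensor action `(P ⊗ Q ⊗ C)·X` (`actTensor`); MW's `(P,Q,R)·X = (∑ⱼ p_{ij} Q Xⱼ R⁻¹)ᵢ`
(p0006:L14–18) is the case `C = (R⁻¹)ᵀ` (`tripleActHom`). [cite: MakamWigderson2021, §1.3 (p0006:L14–18)] -/
def tripleAct (P : Matrix (Fin m) (Fin m) ℂ) (Q C : Matrix (Fin n) (Fin n) ℂ) :
    Tuple n m →ₗ[ℂ] Tuple n m where
  toFun X := fun i => Matrix.of fun a b => actTensor P Q C (fun j c d => X j c d) i a b
  map_add' X Y := by
    funext i; ext a b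
    simp only [Matrix.of_apply, Pi.add_apply, Matrix.add_apply, actTensor_apply, mul_add,
      Finset.sum_add_distrib]
  map_smul' r X := by
    funext i; ext a b
    simp only [Matrix.of_apply, Pi.smul_apply, Matrix.smul_apply, actTensor_apply, smul_eq_mul,
      RingHom.id_apply, Finset.mul_sum]
    refine Finset.sum_congr rfl fun j _ => Finset.sum_congr rfl fun c _ =>
      Finset.sum_congr rfl fun d _ => ?_
    ring

/-- Entries of `tripleAct P Q C X`. [cite: MakamWigderson2021, §1.3 (p0006:L14–18)] -/
theorem tripleAct_apply (P : Matrix (Fin m) (Fin m) ℂ) (Q C : Matrix (Fin n) (Fin n) ℂ)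
    (X : Tuple n m) (i : Fin m) (a b : Fin n) :
    tripleAct P Q C X i a b = ∑ j, ∑ c, ∑ d, P i j * Q a c * C b d * X j c d := rfl

/-- **The printed formula**: `(tripleAct P Q C X)ᵢ = ∑ⱼ p_{ij} Q Xⱼ Cᵀ` (MW p0006:L16 with
`Cᵀ = R⁻¹`). [cite: MakamWigderson2021, §1.3 (p0006:L14–18)] -/
theorem tripleAct_apply_eq_sum (P : Matrix (Fin m) (Fin m) ℂ) (Q C : Matrix (Fin n) (Fin n) ℂ)
    (X : Tuple n m) (i : Fin m) :
    tripleAct P Q C X i = ∑ j, P i j • (Q * X j * Cᵀ) := by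
  ext a b
  rw [tripleAct_apply, Matrix.sum_apply]
  refine Finset.sum_congr rfl fun j _ => ?_
  rw [Matrix.smul_apply, smul_eq_mul, Matrix.mul_apply, Finset.mul_sum]
  -- `(Q * X j * Cᵀ) a b = ∑ d, (Q * X j) a d * C b d = ∑ d, (∑ c, Q a c * X j c d) * C b d`
  rw [Finset.sum_comm]
  refine Finset.sum_congr rfl fun d _ => ?_
  rw [Matrix.transpose_apply, Matrix.mul_apply, Finset.sum_mul, Finset.mul_sum]
  refine Finset.sum_congr rfl fun c _ => ?_
  ring

/-- `tripleAct 1 1 1 = id`. [cite: MakamWigderson2021, §1.3 (p0006:L14–18)] -/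
theorem tripleAct_one : tripleAct (1 : Matrix (Fin m) (Fin m) ℂ) (1 : Matrix (Fin n) (Fin n) ℂ) 1 = 1 := by
  apply LinearMap.ext
  intro X
  funext i; ext a b
  change actTensor (1 : Matrix (Fin m) (Fin m) ℂ) (1 : Matrix (Fin n) (Fin n) ℂ) 1
    (fun j c d => X j c d) i a b = X i a b
  rw [actTensor_one]

/-- Composition law: `tripleAct P Q C ∘ tripleAct P' Q' C' = tripleAct (PP') (QQ') (CC')` (the
tree's `actTensor_actTensor`). [cite: MakamWigderson2021, §1.3 (p0006:L14–18)] -/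
theorem tripleAct_mul (P P' : Matrix (Fin m) (Fin m) ℂ) (Q Q' C C' : Matrix (Fin n) (Fin n) ℂ) :
    tripleAct P Q C * tripleAct P' Q' C' = tripleAct (P * P') (Q * Q') (C * C') := by
  apply LinearMap.ext
  intro X
  funext i; ext a b
  change actTensor P Q C (fun j c d => actTensor P' Q' C' (fun j c d => X j c d) j c d) i a b =
    actTensor (P * P') (Q * Q') (C * C') (fun j c d => X j c d) i a b
  rw [show (fun j c d => actTensor P' Q' C' (fun j c d => X j c d) j c d) =
      actTensor P' Q' C' (fun j c d => X j c d) from rfl, actTensor_actTensor]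

/-- The homomorphism `GL_m × GL_n × GL_n → End(Mat_n^m)`, `(P,Q,R) ↦ (X ↦ (∑ⱼ p_{ij} Q Xⱼ R⁻¹)ᵢ)`
(MW §1.3, p0006:L14–18; `R⁻¹` on the right = `actTensor` with third matrix `(R⁻¹)ᵀ`).
[cite: MakamWigderson2021, §1.3 (p0006:L14–18)] -/
def tripleActMonoidHom (n m : ℕ) :
    GL (Fin m) ℂ × GL (Fin n) ℂ × GL (Fin n) ℂ →* (Tuple n m →ₗ[ℂ] Tuple n m) where
  toFun g := tripleAct (g.1 : Matrix (Fin m) (Fin m) ℂ) (g.2.1 : Matrix (Fin n) (Fin n) ℂ)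
    ((g.2.2⁻¹ : GL (Fin n) ℂ) : Matrix (Fin n) (Fin n) ℂ)ᵀ
  map_one' := by
    simp only [Prod.fst_one, Prod.snd_one, Units.val_one, inv_one, Matrix.transpose_one]
    exact tripleAct_one
  map_mul' g h := by
    rw [tripleAct_mul]
    simp only [Prod.fst_mul, Prod.snd_mul, Units.val_mul, _root_.mul_inv_rev, Matrix.transpose_mul]

/-- **`G_{n,m}`** = the image of `GL_m × GL_n × GL_n → GL(Mat_n^m)` (MW §1.3, p0006:L18: "We will
call the image of this map `G_{n,m}`"). [cite: MakamWigderson2021, §1.3 (p0006:L18)] -/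
def G (n m : ℕ) : Subgroup (LinearMap.GeneralLinearGroup ℂ (Tuple n m)) :=
  (tripleActMonoidHom n m).toHomUnits.range

/-- Membership in `G_{n,m}`: `g` is `X ↦ (∑ⱼ p_{ij} Q Xⱼ R⁻¹)ᵢ` for some
`(P,Q,R) ∈ GL_m × GL_n × GL_n`. [cite: MakamWigderson2021, §1.3 (p0006:L18)] -/
theorem mem_G_iff (g : LinearMap.GeneralLinearGroup ℂ (Tuple n m)) :
    g ∈ G n m ↔ ∃ (P : GL (Fin m) ℂ) (Q R : GL (Fin n) ℂ),
      (g : Tuple n m →ₗ[ℂ] Tuple n m) =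
        tripleAct (P : Matrix (Fin m) (Fin m) ℂ) (Q : Matrix (Fin n) (Fin n) ℂ)
          ((R⁻¹ : GL (Fin n) ℂ) : Matrix (Fin n) (Fin n) ℂ)ᵀ := by
  constructor
  · rintro ⟨⟨P, Q, R⟩, rfl⟩
    exact ⟨P, Q, R, rfl⟩
  · rintro ⟨P, Q, R, h⟩
    refine ⟨⟨P, Q, R⟩, Units.ext ?_⟩
    rw [MonoidHom.coe_toHomUnits]
    exact h.symm

/-- The simultaneous transpose `X = (X₁,…,X_m) ↦ (X₁ᵗ,…,X_mᵗ)` as a linear map.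
[cite: MakamWigderson2021, Thm. 1.13] -/
def transposeMap (n m : ℕ) : Tuple n m →ₗ[ℂ] Tuple n m where
  toFun X := fun i => (X i)ᵀ
  map_add' X Y := by funext i; exact Matrix.transpose_add _ _
  map_smul' r X := by
    funext i
    change (r • X i)ᵀ = r • (X i)ᵀ
    exact Matrix.transpose_smul r (X i)

/-- `τ² = 1`. [cite: MakamWigderson2021, Thm. 1.13] -/
theorem transposeMap_mul_self (n m : ℕ) : transposeMap n m * transposeMap n m = 1 := by
  apply LinearMap.ext
  intro X
  funext i
  exact Matrix.transpose_transpose _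

/-- **`τ`**, "the linear transformation that sends `X = (X₁,…,X_m) ↦ (X₁ᵗ,…,X_mᵗ)`" (Thm. 1.13,
p0006:L35), as an element of `GL(Mat_n^m)` (its own inverse). [cite: MakamWigderson2021, Thm. 1.13] -/
def tau (n m : ℕ) : LinearMap.GeneralLinearGroup ℂ (Tuple n m) :=
  ⟨transposeMap n m, transposeMap n m, transposeMap_mul_self n m, transposeMap_mul_self n m⟩

/-- `τ` acts by transposing every component. [cite: MakamWigderson2021, Thm. 1.13] -/
theorem tau_apply (X : Tuple n m) (i : Fin m) :
    ((tau n m : LinearMap.GeneralLinearGroup ℂ (Tuple n m)) : Tuple n m →ₗ[ℂ] Tuple n m) X i = (X i)ᵀ :=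
  rfl

/-! ### The easy inclusion of Thm. 1.13: `G_{n,m}` and `τ` preserve `SING_{n,m}` (proved) -/

/-- Linear combinations of the components of `(P,Q,C)·X`:
`∑ᵢ cᵢ ((P,Q,C)·X)ᵢ = Q (∑ⱼ (Pᵀc)ⱼ Xⱼ) Cᵀ`. [cite: MakamWigderson2021, §1.3 (p0006:L14–18)] -/
theorem sum_smul_tripleAct (P : Matrix (Fin m) (Fin m) ℂ) (Q C : Matrix (Fin n) (Fin n) ℂ)
    (X : Tuple n m) (c : Fin m → ℂ) :
    ∑ i, c i • tripleAct P Q C X i = Q * (∑ j, (∑ i, c i * P i j) • X j) * Cᵀ := by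
  simp_rw [tripleAct_apply_eq_sum, Finset.smul_sum, smul_smul, Matrix.mul_sum, Matrix.sum_mul,
    Matrix.mul_smul, Matrix.smul_mul, Finset.sum_smul]
  rw [Finset.sum_comm]

/-- Every `(P,Q,C)·` maps `SING_{n,m}` into itself (`det(Q M Cᵀ) = det Q · det M · det C`).
[cite: MakamWigderson2021, Thm. 1.13 (easy inclusion)] -/
theorem tripleAct_mem_SING {P : Matrix (Fin m) (Fin m) ℂ} {Q C : Matrix (Fin n) (Fin n) ℂ}
    {X : Tuple n m} (hX : X ∈ SING n m) : tripleAct P Q C X ∈ SING n m := by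
  rw [mem_SING_iff_forall_det_eq_zero] at hX ⊢
  intro c
  rw [sum_smul_tripleAct, Matrix.det_mul, Matrix.det_mul, hX, mul_zero, zero_mul]

/-- `τ` maps `SING_{n,m}` into itself (`det Mᵀ = det M`). [cite: MakamWigderson2021, Thm. 1.13 (easy inclusion)] -/
theorem transposeMap_mem_SING {X : Tuple n m} (hX : X ∈ SING n m) : transposeMap n m X ∈ SING n m := by
  rw [mem_SING_iff_forall_det_eq_zero] at hX ⊢
  intro c
  have : ∑ i, c i • transposeMap n m X i = (∑ i, c i • X i)ᵀ := by
    rw [Matrix.transpose_sum]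
    refine Finset.sum_congr rfl fun i _ => ?_
    rw [Matrix.transpose_smul]
    rfl
  rw [this, Matrix.det_transpose, hX]

section SymmetryOfSubgroup

variable {V : Type*} [AddCommGroup V] [Module ℂ V]

/-- A subgroup all of whose elements map `S` into `S` consists of symmetries of `S` (apply the
hypothesis to `g⁻¹` for the reverse inclusion). [cite: MakamWigderson2021, Def. 1.10] -/
theorem mem_symmetryGroup_of_subgroup_mapsTo {H : Subgroup (LinearMap.GeneralLinearGroup ℂ V)}
    {S : Set V} (hH : ∀ h ∈ H, Set.MapsTo (fun v => (h : V →ₗ[ℂ] V) v) S S)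
    {g : LinearMap.GeneralLinearGroup ℂ V} (hg : g ∈ H) : g ∈ symmetryGroup S := by
  rw [mem_symmetryGroup_iff]
  refine Set.Subset.antisymm (Set.mapsTo_iff_image_subset.mp (hH g hg)) fun w hw => ?_
  refine ⟨((g⁻¹ : LinearMap.GeneralLinearGroup ℂ V) : V →ₗ[ℂ] V) w, hH _ (H.inv_mem hg) hw, ?_⟩
  show (g : V →ₗ[ℂ] V) (((g⁻¹ : LinearMap.GeneralLinearGroup ℂ V) : V →ₗ[ℂ] V) w) = w
  rw [← Module.End.mul_apply, ← Units.val_mul, mul_inv_cancel, Units.val_one, Module.End.one_apply]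

end SymmetryOfSubgroup

/-- **`G_{n,m} ≤ 𝒢_{SING_{n,m}}`** — the easy inclusion of Thm. 1.13, PROVED.
[cite: MakamWigderson2021, Thm. 1.13 (easy inclusion)] -/
theorem G_le_symmetryGroup_SING : G n m ≤ symmetryGroup (SING n m) := by
  intro g hg
  refine mem_symmetryGroup_of_subgroup_mapsTo (H := G n m) (fun h hh X hX => ?_) hg
  obtain ⟨x, rfl⟩ := hh
  show (((tripleActMonoidHom n m).toHomUnits x : LinearMap.GeneralLinearGroup ℂ (Tuple n m)) :
      Tuple n m →ₗ[ℂ] Tuple n m) X ∈ SING n m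
  rw [MonoidHom.coe_toHomUnits]
  exact tripleAct_mem_SING hX

/-- **`τ ∈ 𝒢_{SING_{n,m}}`** — PROVED. [cite: MakamWigderson2021, Thm. 1.13 (easy inclusion)] -/
theorem tau_mem_symmetryGroup_SING : tau n m ∈ symmetryGroup (SING n m) := by
  refine mem_symmetryGroup_of_subgroup_mapsTo (H := Subgroup.zpowers (tau n m)) (fun h hh X hX => ?_)
    (Subgroup.mem_zpowers _)
  -- `⟨τ⟩ = {1, τ}`: every power of `τ` is `1` or `τ`
  obtain ⟨k, rfl⟩ := Subgroup.mem_zpowers_iff.mp hh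
  have hτ2 : tau n m ^ (2 : ℕ) = 1 := Units.ext (transposeMap_mul_self n m)
  have hk : (tau n m) ^ k = 1 ∨ (tau n m) ^ k = tau n m := by
    rcases Int.even_or_odd k with ⟨j, rfl⟩ | ⟨j, rfl⟩
    · left
      rw [← two_mul, _root_.zpow_mul, show (tau n m) ^ (2 : ℤ) = 1 from by rw [zpow_ofNat, hτ2],
        _root_.one_zpow]
    · right
      rw [_root_.zpow_add, _root_.zpow_mul, show (tau n m) ^ (2 : ℤ) = 1 from by rw [zpow_ofNat, hτ2],
        _root_.one_zpow, one_mul, zpow_one]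
  rcases hk with hk | hk <;> rw [hk]
  · exact hX
  · exact transposeMap_mem_SING hX

/-- **The inclusion `G_{n,m} ∪ G_{n,m}·τ ⊆ 𝒢_{SING_{n,m}}` of Thm. 1.13**, PROVED (the reverse
inclusion is the content of the paper, §9). [cite: MakamWigderson2021, Thm. 1.13 (easy inclusion)] -/
theorem mem_symmetryGroup_SING_of_mem_G_or {g : LinearMap.GeneralLinearGroup ℂ (Tuple n m)}
    (hg : g ∈ G n m ∨ g * tau n m ∈ G n m) : g ∈ symmetryGroup (SING n m) := by
  rcases hg with hg | hg
  · exact G_le_symmetryGroup_SING hg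
  · have h1 : g = (g * tau n m) * tau n m := by
      rw [mul_assoc, show tau n m * tau n m = 1 from Units.ext (transposeMap_mul_self n m), mul_one]
    rw [h1]
    exact (symmetryGroup (SING n m)).mul_mem (G_le_symmetryGroup_SING hg) tau_mem_symmetryGroup_SING

/-! ### The easy inclusion of Thm. 1.14: `G_{n,m}` preserves `NSING_{n,m}` (proved) -/

section NcRankInvariance

variable {ι κ : Type*} [Fintype ι] [Fintype κ] [DecidableEq ι] [DecidableEq κ]

omit [DecidableEq ι] [DecidableEq κ] in
/-- Left multiplication by `Q` maps the image `𝓑(V)` onto `(Q𝓑)(V)`. [cite: BlaeserJindalPandey2018, Def 2.3, p. 5] -/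
theorem imageSubspace_image_mul_left (Q : Matrix ι ι ℂ) (𝓑 : Set (Matrix ι κ ℂ))
    (V : Submodule ℂ (κ → ℂ)) :
    imageSubspace ((fun B => Q * B) '' 𝓑) V = (imageSubspace 𝓑 V).map Q.mulVecLin := by
  rw [imageSubspace, imageSubspace, Submodule.map_span]
  congr 1
  ext w
  simp only [Set.mem_setOf_eq, Set.mem_image]
  constructor
  · rintro ⟨_, ⟨B, hB, rfl⟩, v, hv, rfl⟩
    exact ⟨B.mulVec v, ⟨B, hB, v, hv, rfl⟩, by rw [Matrix.mulVecLin_apply, Matrix.mulVec_mulVec]⟩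
  · rintro ⟨_, ⟨B, hB, v, hv, rfl⟩, rfl⟩
    exact ⟨Q * B, ⟨B, hB, rfl⟩, v, hv, by rw [Matrix.mulVecLin_apply, Matrix.mulVec_mulVec]⟩

omit [Fintype ι] [DecidableEq ι] [DecidableEq κ] in
/-- Right multiplication by `C` replaces `V` by `C(V)`: `(𝓑C)(V) = 𝓑(CV)`. [cite: BlaeserJindalPandey2018, Def 2.3, p. 5] -/
theorem imageSubspace_image_mul_right (C : Matrix κ κ ℂ) (𝓑 : Set (Matrix ι κ ℂ))
    (V : Submodule ℂ (κ → ℂ)) :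
    imageSubspace ((fun B => B * C) '' 𝓑) V = imageSubspace 𝓑 (V.map C.mulVecLin) := by
  rw [imageSubspace, imageSubspace]
  congr 1
  ext w
  simp only [Set.mem_setOf_eq, Set.mem_image, Submodule.mem_map]
  constructor
  · rintro ⟨_, ⟨B, hB, rfl⟩, v, hv, rfl⟩
    exact ⟨B, hB, C.mulVec v, ⟨v, hv, rfl⟩, by rw [Matrix.mulVec_mulVec]⟩
  · rintro ⟨B, hB, _, ⟨v, hv, rfl⟩, rfl⟩
    exact ⟨B * C, ⟨B, hB, rfl⟩, v, hv, by rw [Matrix.mulVecLin_apply, Matrix.mulVec_mulVec]⟩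

omit [DecidableEq κ] in
/-- The cost `codim V + dim 𝓑(V)` is unchanged by an invertible left multiplication.
[cite: BlaeserJindalPandey2018, Def 2.5, p. 5] -/
theorem shrunkCost_image_mul_left {Q : Matrix ι ι ℂ} (hQ : IsUnit Q) (𝓑 : Set (Matrix ι κ ℂ))
    (V : Submodule ℂ (κ → ℂ)) : shrunkCost ((fun B => Q * B) '' 𝓑) V = shrunkCost 𝓑 V := by
  rw [shrunkCost, shrunkCost, imageSubspace_image_mul_left]
  congr 1
  exact (Submodule.equivMapOfInjective _ (Matrix.mulVec_injective_iff_isUnit.mpr hQ) _).finrank_eq.symm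

omit [Fintype ι] [DecidableEq ι] in
/-- An invertible right multiplication transports the cost: `cost_{𝓑C}(V) = cost_𝓑(CV)`.
[cite: BlaeserJindalPandey2018, Def 2.5, p. 5] -/
theorem shrunkCost_image_mul_right {C : Matrix κ κ ℂ} (hC : IsUnit C) (𝓑 : Set (Matrix ι κ ℂ))
    (V : Submodule ℂ (κ → ℂ)) :
    shrunkCost ((fun B => B * C) '' 𝓑) V = shrunkCost 𝓑 (V.map C.mulVecLin) := by
  rw [shrunkCost, shrunkCost, imageSubspace_image_mul_right]
  congr 1
  have h1 := Submodule.finrank_quotient_add_finrank V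
  have h2 := Submodule.finrank_quotient_add_finrank (V.map C.mulVecLin)
  have h3 : Module.finrank ℂ (V.map C.mulVecLin) = Module.finrank ℂ V :=
    (Submodule.equivMapOfInjective _ (Matrix.mulVec_injective_iff_isUnit.mpr hC) _).finrank_eq.symm
  omega

omit [DecidableEq κ] in
/-- **`ncrk(Q𝓑) = ncrk(𝓑)`** for invertible `Q`. [cite: BlaeserJindalPandey2018, Def 2.5, p. 5] -/
theorem ncRank_image_mul_left {Q : Matrix ι ι ℂ} (hQ : IsUnit Q) (𝓑 : Set (Matrix ι κ ℂ)) :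
    ncRank ((fun B => Q * B) '' 𝓑) = ncRank 𝓑 := by
  have h : shrunkCost ((fun B => Q * B) '' 𝓑) = shrunkCost 𝓑 :=
    funext fun V => shrunkCost_image_mul_left hQ 𝓑 V
  rw [ncRank, ncRank, h]

omit [Fintype ι] [DecidableEq ι] in
/-- **`ncrk(𝓑C) = ncrk(𝓑)`** for invertible `C` (`V ↦ CV` permutes the subspaces).
[cite: BlaeserJindalPandey2018, Def 2.5, p. 5] -/
theorem ncRank_image_mul_right {C : Matrix κ κ ℂ} (hC : IsUnit C) (𝓑 : Set (Matrix ι κ ℂ)) :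
    ncRank ((fun B => B * C) '' 𝓑) = ncRank 𝓑 := by
  have hCdet : IsUnit C.det := (Matrix.isUnit_iff_isUnit_det C).mp hC
  apply le_antisymm
  · obtain ⟨V, hV⟩ := exists_shrunkCost_eq_ncRank 𝓑
    have h := ncRank_le_shrunkCost ((fun B => B * C) '' 𝓑) (V.map (C⁻¹).mulVecLin)
    rw [shrunkCost_image_mul_right hC, ← Submodule.map_comp, ← Matrix.mulVecLin_mul,
      Matrix.mul_nonsing_inv C hCdet, Matrix.mulVecLin_one, Submodule.map_id, hV] at h
    exact h
  · obtain ⟨V, hV⟩ := exists_shrunkCost_eq_ncRank ((fun B => B * C) '' 𝓑)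
    have h := ncRank_le_shrunkCost 𝓑 (V.map C.mulVecLin)
    rw [← shrunkCost_image_mul_right hC, hV] at h
    exact h

end NcRankInvariance

/-- The matrix space of `(P,Q,C)·X` is the space of `{Q Xⱼ Cᵀ}` when `P` is invertible.
[cite: MakamWigderson2021, §1.3 (p0006:L14–18)] -/
theorem span_range_tripleAct (P : GL (Fin m) ℂ) (Q C : Matrix (Fin n) (Fin n) ℂ) (X : Tuple n m) :
    Submodule.span ℂ (Set.range (tripleAct (P : Matrix (Fin m) (Fin m) ℂ) Q C X)) =
      Submodule.span ℂ (Set.range fun j => Q * X j * Cᵀ) := by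
  apply le_antisymm
  · rw [Submodule.span_le]
    rintro _ ⟨i, rfl⟩
    rw [tripleAct_apply_eq_sum]
    exact Submodule.sum_mem _ fun j _ => Submodule.smul_mem _ _ (Submodule.subset_span ⟨j, rfl⟩)
  · rw [Submodule.span_le]
    rintro _ ⟨j, rfl⟩
    -- `Q Xⱼ Cᵀ = ∑ᵢ (P⁻¹)ⱼᵢ ((P,Q,C)·X)ᵢ`
    have key : (∑ i, ((P⁻¹ : GL (Fin m) ℂ) : Matrix (Fin m) (Fin m) ℂ) j i •
        tripleAct (P : Matrix (Fin m) (Fin m) ℂ) Q C X i) = Q * X j * Cᵀ := by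
      simp_rw [tripleAct_apply_eq_sum, Finset.smul_sum, smul_smul]
      rw [Finset.sum_comm]
      have hPP : ∀ k, (∑ i, ((P⁻¹ : GL (Fin m) ℂ) : Matrix (Fin m) (Fin m) ℂ) j i *
          (P : Matrix (Fin m) (Fin m) ℂ) i k) = if j = k then 1 else 0 := fun k => by
        rw [← Matrix.mul_apply, ← Units.val_mul, inv_mul_cancel, Units.val_one, Matrix.one_apply]
      simp_rw [← Finset.sum_smul, hPP, ite_smul, one_smul, zero_smul, Finset.sum_ite_eq,
        Finset.mem_univ, if_true]
    show Q * X j * Cᵀ ∈ Submodule.span ℂ (Set.range (tripleAct (P : Matrix (Fin m) (Fin m) ℂ) Q C X))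
    rw [← key]
    exact Submodule.sum_mem _ fun i _ => Submodule.smul_mem _ _ (Submodule.subset_span ⟨i, rfl⟩)

/-- **`(P,Q,C)·` preserves the non-commutative rank** (`P, Q, C` invertible): the matrix space
changes by `𝓑 ↦ Q 𝓑 Cᵀ` (and a change of spanning set). [cite: MakamWigderson2021, Thm. 1.14 (easy inclusion)] -/
theorem ncRank_range_tripleAct (P : GL (Fin m) ℂ) (Q C : GL (Fin n) ℂ) (X : Tuple n m) :
    ncRank (Set.range (tripleAct (P : Matrix (Fin m) (Fin m) ℂ) (Q : Matrix (Fin n) (Fin n) ℂ)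
      (C : Matrix (Fin n) (Fin n) ℂ) X)) = ncRank (Set.range X) := by
  rw [← ncRank_span, span_range_tripleAct, ncRank_span]
  have hset : (Set.range fun j => (Q : Matrix (Fin n) (Fin n) ℂ) * X j * (C : Matrix (Fin n) (Fin n) ℂ)ᵀ) =
      (fun B => (Q : Matrix (Fin n) (Fin n) ℂ) * B) ''
        ((fun B => B * (C : Matrix (Fin n) (Fin n) ℂ)ᵀ) '' Set.range X) := by
    ext B
    simp only [Set.mem_range, Set.mem_image]
    constructor
    · rintro ⟨j, rfl⟩
      exact ⟨X j * (C : Matrix (Fin n) (Fin n) ℂ)ᵀ, ⟨X j, ⟨j, rfl⟩, rfl⟩, by rw [Matrix.mul_assoc]⟩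
    · rintro ⟨_, ⟨_, ⟨j, rfl⟩, rfl⟩, rfl⟩
      exact ⟨j, by rw [Matrix.mul_assoc]⟩
  rw [hset, ncRank_image_mul_left Q.isUnit, ncRank_image_mul_right]
  rw [Matrix.isUnit_transpose]
  exact C.isUnit

/-- Every `(P,Q,C)·` with invertible `P, Q, C` maps `NSING_{n,m}` into itself.
[cite: MakamWigderson2021, Thm. 1.14 (easy inclusion)] -/
theorem tripleAct_mem_NSING (P : GL (Fin m) ℂ) (Q C : GL (Fin n) ℂ) {X : Tuple n m}
    (hX : X ∈ NSING n m) :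
    tripleAct (P : Matrix (Fin m) (Fin m) ℂ) (Q : Matrix (Fin n) (Fin n) ℂ)
      (C : Matrix (Fin n) (Fin n) ℂ) X ∈ NSING n m := by
  rw [mem_NSING_iff] at hX ⊢
  rwa [ncRank_range_tripleAct]

/-- **`G_{n,m} ≤ 𝒢_{NSING_{n,m}}`** — the part of the easy inclusion of Thm. 1.14 not involving `τ`,
PROVED (for `τ` one needs the transpose invariance of the non-commutative rank, not in the tree).
[cite: MakamWigderson2021, Thm. 1.14 (easy inclusion)] -/
theorem G_le_symmetryGroup_NSING : G n m ≤ symmetryGroup (NSING n m) := by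
  intro g hg
  refine mem_symmetryGroup_of_subgroup_mapsTo (H := G n m) (fun h hh X hX => ?_) hg
  obtain ⟨⟨P, Q, R⟩, rfl⟩ := hh
  show (((tripleActMonoidHom n m).toHomUnits (P, Q, R) : LinearMap.GeneralLinearGroup ℂ (Tuple n m)) :
      Tuple n m →ₗ[ℂ] Tuple n m) X ∈ NSING n m
  rw [MonoidHom.coe_toHomUnits]
  have hC : IsUnit ((R⁻¹ : GL (Fin n) ℂ) : Matrix (Fin n) (Fin n) ℂ)ᵀ := by
    rw [Matrix.isUnit_transpose]; exact (R⁻¹).isUnit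
  exact tripleAct_mem_NSING P Q hC.unit hX

/-! ### §10: coordinate subspaces of `SING` and `NSING` -/

/-- **Coordinate subspace `L_I = {X ∈ Mat_n^m | Supp(X) ⊆ I}`** for `I ⊆ [m] × [n] × [n]`
(MW Def. 10.4, p0026:L31; Def. 10.2: `(i,j,k) ∈ Supp(X)` iff the `(j,k)` entry of `Xᵢ` is nonzero;
Def. 2.9 for a general weight basis). [cite: MakamWigderson2021, Def. 10.4] -/
def coordSubspace (I : Set (Fin m × Fin n × Fin n)) : Set (Tuple n m) :=
  {X | ∀ i j k, X i j k ≠ 0 → (i, j, k) ∈ I}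

/-- `π_{2,3}(I) ⊆ [n] × [n]` (MW §10, p0026:L14–18). [cite: MakamWigderson2021, Def. 10.2 (π₂,₃)] -/
def proj23 (I : Set (Fin m × Fin n × Fin n)) : Set (Fin n × Fin n) :=
  Prod.snd '' I

/-- "`J ⊆ [n] × [n]` contains a permutation `σ ∈ S_n` if `{(i,σ(i)) | 1 ≤ i ≤ n} ⊆ J`"; `J` is
*permutation free* if `¬ ContainsPerm J` (MW §10.1, p0026:L42). [cite: MakamWigderson2021, §10.1 (p0026:L42)] -/
def ContainsPerm (J : Set (Fin n × Fin n)) : Prop :=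
  ∃ σ : Equiv.Perm (Fin n), ∀ i, (i, σ i) ∈ J

/-- If `π_{2,3}(I)` is permutation free then every `X ∈ L_I` is in `SING`: each term of the Leibniz
expansion of `det(∑ tᵢXᵢ)` contains an entry outside the support (MW Prop. 10.6, proof of Prop. 10.5).
[cite: MakamWigderson2021, Prop. 10.6] -/
theorem coordSubspace_subset_SING_of_not_containsPerm {I : Set (Fin m × Fin n × Fin n)}
    (hI : ¬ ContainsPerm (proj23 I)) : coordSubspace I ⊆ SING n m := by
  intro X hX
  rw [mem_SING_iff, Matrix.det_apply]
  refine Finset.sum_eq_zero fun σ _ => ?_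
  -- some position `(σ k, k)` is outside `π_{2,3}(I)`
  have hσ : ∃ k, (σ k, k) ∉ proj23 I := by
    by_contra! hall
    exact hI ⟨σ⁻¹, fun j => by simpa using hall (σ⁻¹ j)⟩
  obtain ⟨k, hk⟩ := hσ
  have hentry : pencil X (σ k) k = 0 := by
    simp only [pencil, Matrix.sum_apply, Matrix.smul_apply, Matrix.map_apply, smul_eq_mul]
    refine Finset.sum_eq_zero fun l _ => ?_
    have : X l (σ k) k = 0 := by
      by_contra hne
      exact hk ⟨(l, σ k, k), hX l (σ k) k hne, rfl⟩
    rw [this, map_zero, mul_zero]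
  have hprod : (∏ i, pencil X (σ i) i) = 0 := Finset.prod_eq_zero (Finset.mem_univ k) hentry
  rw [hprod, smul_zero]

/-- If `π_{2,3}(I)` contains a permutation `σ` then `L_I ⊄ SING`: the tuple with a single `1` at
`(i, σ(i))` in `X_{pᵢ}` lies in `L_I` and `∑ Xᵢ` is the permutation matrix of `σ` (MW, proof of
Prop. 10.5, "Conversely…", p0026:L52–57). [cite: MakamWigderson2021, Prop. 10.6] -/
theorem not_coordSubspace_subset_SING_of_containsPerm {I : Set (Fin m × Fin n × Fin n)}
    (hI : ContainsPerm (proj23 I)) : ¬ coordSubspace I ⊆ SING n m := by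
  classical
  obtain ⟨σ, hσ⟩ := hI
  have hp : ∀ j : Fin n, ∃ p : Fin m, (p, j, σ j) ∈ I := fun j => by
    obtain ⟨⟨p, q⟩, hq, hpq⟩ := hσ j
    simp only at hpq
    exact ⟨p, by rw [← hpq]; exact hq⟩
  choose p hpI using hp
  let X : Tuple n m := fun l => Matrix.of fun j k => if l = p j ∧ k = σ j then (1 : ℂ) else 0
  have hXL : X ∈ coordSubspace I := by
    intro l j k hne
    simp only [X, Matrix.of_apply, ne_eq, ite_eq_right_iff, one_ne_zero, imp_false, not_not] at hne
    obtain ⟨rfl, rfl⟩ := hne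
    exact hpI j
  intro hsub
  have hdet := (mem_SING_iff_forall_det_eq_zero X).mp (hsub hXL) (fun _ => 1)
  have hsum : (∑ l, (1 : ℂ) • X l) = (σ.permMatrix ℂ) := by
    ext j k
    simp only [one_smul, Matrix.sum_apply, X, Matrix.of_apply, Equiv.Perm.permMatrix,
      Equiv.toPEquiv_apply, PEquiv.toMatrix_apply, Option.mem_def, Option.some.injEq]
    rw [Finset.sum_ite, Finset.sum_const_zero, add_zero, Finset.sum_const, nsmul_eq_mul, mul_one]
    by_cases hk : k = σ j
    · subst hk
      have : (Finset.univ.filter fun l : Fin m => l = p j ∧ σ j = σ j) = {p j} := by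
        ext l; simp
      rw [this, Finset.card_singleton, Nat.cast_one, if_pos rfl]
    · have : (Finset.univ.filter fun l : Fin m => l = p j ∧ k = σ j) = ∅ := by
        ext l; simp [hk]
      rw [this, Finset.card_empty, Nat.cast_zero, if_neg (fun h => hk h.symm)]
  rw [hsum, Matrix.det_permutation] at hdet
  rcases Int.units_eq_one_or (Equiv.Perm.sign σ) with h1 | h1 <;> simp [h1] at hdet

/-- **MW Prop. 10.6** (p0026:L61): "For `I ⊆ [m] × [n] × [n]`, `L_I ⊆ SING_{n,m}` if and only if
`π_{2,3}(I) ⊆ [n] × [n]` is permutation free." PROVED. [cite: MakamWigderson2021, Prop. 10.6] -/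
theorem coordSubspace_subset_SING_iff (I : Set (Fin m × Fin n × Fin n)) :
    coordSubspace I ⊆ SING n m ↔ ¬ ContainsPerm (proj23 I) :=
  ⟨fun h hI => not_coordSubspace_subset_SING_of_containsPerm hI h,
    coordSubspace_subset_SING_of_not_containsPerm⟩

/-- The direction `→` of MW Prop. 10.5: `L_I ⊆ NSING` forces `π_{2,3}(I)` permutation free (since
`NSING ⊆ SING`, by Prop. 10.6). [cite: MakamWigderson2021, Prop. 10.5] -/
theorem not_containsPerm_of_coordSubspace_subset_NSING {I : Set (Fin m × Fin n × Fin n)}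
    (h : coordSubspace I ⊆ NSING n m) : ¬ ContainsPerm (proj23 I) :=
  (coordSubspace_subset_SING_iff I).mp (h.trans NSING_subset_SING)

/-- **A Hall blocker shrinks a subspace**: if the columns `k ∈ A` of every `Xₗ` are supported on
the rows `N` and `|N| < |A|`, then `ncrk{X₁,…,X_m} < n` — every `Xₗ` maps `span{e_k : k ∈ A}` into
`span{e_j : j ∈ N}` (MW Prop. 10.5, proof; here via the tree's cover bound `ncRank_le_of_cover`).
[cite: MakamWigderson2021, Prop. 10.5 (proof)] -/
theorem ncRank_lt_of_blocker (X : Tuple n m) {A N : Finset (Fin n)}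
    (hAN : ∀ l j k, k ∈ A → X l j k ≠ 0 → j ∈ N) (hcard : N.card < A.card) :
    ncRank (Set.range X) < n := by
  classical
  let W : Submodule ℂ (Fin n → ℂ) :=
    Submodule.span ℂ (Set.range fun k : A => (Pi.single (k : Fin n) (1 : ℂ) : Fin n → ℂ))
  let U : Submodule ℂ (Fin n → ℂ) :=
    Submodule.span ℂ ((N.image fun j => (Pi.single j (1 : ℂ) : Fin n → ℂ)) : Set (Fin n → ℂ))
  have hcover : ∀ B ∈ Set.range X, W.map B.mulVecLin ≤ U := by
    rintro _ ⟨l, rfl⟩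
    rw [Submodule.map_le_iff_le_comap, Submodule.span_le]
    rintro _ ⟨⟨k, hk⟩, rfl⟩
    rw [SetLike.mem_coe, Submodule.mem_comap, Matrix.mulVecLin_apply, Matrix.mulVec_single_one]
    have hcol : (X l).col k = ∑ j ∈ N, X l j k • (Pi.single j (1 : ℂ) : Fin n → ℂ) := by
      funext j'
      simp only [Matrix.col_apply, Finset.sum_apply, Pi.smul_apply, Pi.single_apply, smul_eq_mul,
        mul_ite, mul_one, mul_zero]
      rw [Finset.sum_ite_eq]
      split_ifs with h
      · rfl
      · by_contra hne
        exact h (hAN l j' k hk hne)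
    rw [hcol]
    exact Submodule.sum_mem _ fun j hj =>
      Submodule.smul_mem _ _ (Submodule.subset_span (Finset.mem_coe.mpr (Finset.mem_image_of_mem _ hj)))
  have hle := ncRank_le_of_cover (Set.range X) U W hcover
  have hU : Module.finrank ℂ U ≤ N.card := (finrank_span_finset_le_card _).trans Finset.card_image_le
  have hW : Module.finrank ℂ W = A.card := by
    have hli : LinearIndependent ℂ fun k : A => (Pi.single (k : Fin n) (1 : ℂ) : Fin n → ℂ) := by
      have := (Pi.basisFun ℂ (Fin n)).linearIndependent.comp (fun k : A => (k : Fin n))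
        Subtype.val_injective
      convert this using 1
      funext k
      simp [Pi.basisFun_apply]
    show Module.finrank ℂ (Submodule.span ℂ (Set.range fun k : A =>
      (Pi.single (k : Fin n) (1 : ℂ) : Fin n → ℂ))) = A.card
    rw [finrank_span_eq_card hli, Fintype.card_coe]
  have hq := Submodule.finrank_quotient_add_finrank W
  rw [Module.finrank_fintype_fun_eq_card, Fintype.card_fin] at hq
  omega

/-- If `π_{2,3}(I)` is permutation free then `L_I ⊆ NSING`: by Hall's marriage theorem
(König) the support pattern has a set `A` of columns meeting fewer than `|A|` rows, so every
`X ∈ L_I` has a shrunk subspace (MW Prop. 10.5, "`⇐`", there via the null cone of the torus of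
`SL_n × SL_n`). [cite: MakamWigderson2021, Prop. 10.5] -/
theorem coordSubspace_subset_NSING_of_not_containsPerm {I : Set (Fin m × Fin n × Fin n)}
    (hI : ¬ ContainsPerm (proj23 I)) : coordSubspace I ⊆ NSING n m := by
  classical
  intro X hX
  rw [mem_NSING_iff]
  -- Hall: the relation `k ~ j :⇔ (j,k) ∈ π_{2,3}(I)` has no transversal
  have hno : ¬ ∃ f : Fin n → Fin n, Function.Injective f ∧ ∀ k, (f k, k) ∈ proj23 I := by
    rintro ⟨f, hf, hfr⟩
    have hbij : Function.Bijective f := Finite.injective_iff_bijective.mp hf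
    refine hI ⟨(Equiv.ofBijective f hbij).symm, fun j => ?_⟩
    have h1 := hfr ((Equiv.ofBijective f hbij).symm j)
    rwa [Equiv.ofBijective_apply_symm_apply f hbij] at h1
  rw [← Fintype.all_card_le_filter_rel_iff_exists_injective (fun k j => (j, k) ∈ proj23 I)] at hno
  push Not at hno
  obtain ⟨A, hA⟩ := hno
  refine ncRank_lt_of_blocker X (A := A) (fun l j k hk hj => ?_) hA
  simp only [Finset.mem_filter, Finset.mem_univ, true_and]
  exact ⟨k, hk, (l, j, k), hX l j k hj, rfl⟩

/-- **MW Prop. 10.5** (p0026:L44): "For `I ⊆ [m] × [n] × [n]`, `L_I ⊆ NSING_{n,m}` if and only if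
`π_{2,3}(I) ⊆ [n] × [n]` is permutation free." PROVED (`→`: `NSING ⊆ SING` and Prop. 10.6; `←`:
Hall/König on the support pattern). [cite: MakamWigderson2021, Prop. 10.5] -/
theorem coordSubspace_subset_NSING_iff (I : Set (Fin m × Fin n × Fin n)) :
    coordSubspace I ⊆ NSING n m ↔ ¬ ContainsPerm (proj23 I) :=
  ⟨not_containsPerm_of_coordSubspace_subset_NSING, coordSubspace_subset_NSING_of_not_containsPerm⟩

/-- **MW Cor. 10.7** (p0026:L66): "For `I ⊆ [m] × [n] × [n]`, `L_I ⊆ NSING_{n,m}` if and only if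
`L_I ⊆ SING_{n,m}`." PROVED. [cite: MakamWigderson2021, Cor. 10.7] -/
theorem coordSubspace_subset_NSING_iff_subset_SING (I : Set (Fin m × Fin n × Fin n)) :
    coordSubspace I ⊆ NSING n m ↔ coordSubspace I ⊆ SING n m := by
  rw [coordSubspace_subset_NSING_iff, coordSubspace_subset_SING_iff]

/-- The `3`-tuple `X = (E₁₂ − E₂₁, E₁₃ − E₃₁, E₂₃ − E₃₂) ∈ Mat₃³` of MW §10.2 (p0027; a basis of
`𝔰𝔬₃`): in `SING_{3,3}` but not in `NSING_{3,3}`. [cite: MakamWigderson2021, §10.2 (example, p0027)] -/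
def skewTriple : Tuple 3 3 :=
  ![!![0, 1, 0; -1, 0, 0; 0, 0, 0], !![0, 0, 1; 0, 0, 0; -1, 0, 0], !![0, 0, 0; 0, 0, 1; 0, -1, 0]]

/-- `skewTriple ∈ SING_{3,3}`: `∑ cᵢXᵢ` is a skew-symmetric `3 × 3` matrix, hence singular
(MW §10.2, p0027). PROVED. [cite: MakamWigderson2021, §10.2 (example, p0027)] -/
theorem skewTriple_mem_SING : skewTriple ∈ SING 3 3 := by
  rw [mem_SING_iff_forall_det_eq_zero]
  intro c
  rw [Fin.sum_univ_three]
  simp only [skewTriple, Matrix.cons_val_zero, Matrix.cons_val_one, Matrix.head_cons,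
    Matrix.cons_val_two, Matrix.tail_cons]
  rw [Matrix.det_fin_three]
  simp [Matrix.add_apply]
  ring

/-! ### `skewTriple ∉ NSING_{3,3}`: a blow-up certificate (proved) -/

/-- The `2 × 2` matrices `T₁, T₂, T₃` of the certificate `∑ᵢ Xᵢ ⊗ Tᵢ` (an invertible member of the
square `2`-blow-up of `span{X₁,X₂,X₃}`, [DM18, Lemma 1.8 / Cor 4.7]). [folklore] -/
def certT : Fin 3 → Matrix (Fin 2) (Fin 2) ℂ :=
  ![!![1, 0; 0, -1], !![0, 1; 1, 0], !![0, 1; 0, 0]]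

/-- The certificate `M = ∑ᵢ Xᵢ ⊗ₖ Tᵢ ∈ span{X₁,X₂,X₃}^{(2)}` (`X = skewTriple`). [folklore] -/
def certM : Matrix (Fin 3 × Fin 2) (Fin 3 × Fin 2) ℂ :=
  ∑ i, Matrix.kroneckerMap (· * ·) (skewTriple i) (certT i)

/-- An explicit inverse of `certM` (integer entries; `det certM = 1`). [folklore] -/
def certN : Matrix (Fin 3 × Fin 2) (Fin 3 × Fin 2) ℂ :=
  Matrix.of fun p q =>
    (![![0, 0, 0, 0, 0, -1], ![0, 0, 0, 1, 0, 0], ![1, 0, -1, 0, 0, 1], ![0, 0, 0, -1, -1, 0],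
      ![0, 1, 0, -1, -1, 0], ![0, 0, 1, 0, 0, -1]] : Fin 6 → Fin 6 → ℂ)
      (finProdFinEquiv p) (finProdFinEquiv q)

/-- `certM · certN = 1` (a `6 × 6` computation; the full-rank certificate of [DM18, Cor 4.7] for the
`𝔰𝔬₃` example of MW §10.2). [cite: MakamWigderson2021, §10.2 (example, p0027)] -/
private theorem certM_mul_certN : certM * certN = 1 := by
  ext p q
  rcases p with ⟨i, a⟩
  rcases q with ⟨j, b⟩
  fin_cases i <;> fin_cases a <;> fin_cases j <;> fin_cases b <;>
    simp [certM, certN, certT, skewTriple, Matrix.mul_apply, Fintype.sum_prod_type,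
      Fin.sum_univ_three, Fin.sum_univ_two, Matrix.kroneckerMap_apply, finProdFinEquiv,
      Matrix.cons_val_zero, Matrix.cons_val_one, Matrix.cons_val_two, Matrix.head_cons,
      Matrix.tail_cons]

/-- `certM` lies in the square `2`-blow-up of `{X₁, X₂, X₃}` ([DM18, Def 1.5]).
[cite: MakamWigderson2021, §10.2 (example, p0027)] -/
private theorem certM_mem_blowUp : certM ∈ blowUp (Set.range skewTriple) (Fin 2) (Fin 2) :=
  Submodule.sum_mem _ fun i _ => Submodule.subset_span ⟨skewTriple i, ⟨i, rfl⟩, certT i, rfl⟩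

/-- **`skewTriple ∉ NSING_{3,3}`** (MW §10.2, p0027: "is in `SING_{3,3}` but not in `NSING_{3,3}`
(see for example [FR] or [DM-ncrk])") — PROVED by the full-rank blow-up certificate `∑ᵢ Xᵢ ⊗ Tᵢ`
(the tree's `ncRank_eq_card_of_mem_blowUp`, [DM18, Cor 4.7]): `ncrk{X₁,X₂,X₃} = 3`.
[cite: MakamWigderson2021, §10.2 (example, p0027)] -/
theorem skewTriple_not_mem_NSING : skewTriple ∉ NSING 3 3 := by
  have hunit : IsUnit certM := by
    rw [Matrix.isUnit_iff_isUnit_det]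
    have h := congrArg Matrix.det certM_mul_certN
    rw [Matrix.det_mul, Matrix.det_one] at h
    exact IsUnit.of_mul_eq_one _ h
  have hrank : certM.rank = Fintype.card (Fin 3 × Fin 2) := Matrix.rank_of_isUnit certM hunit
  have hnc : ncRank (Set.range skewTriple) = Fintype.card (Fin 3) :=
    ncRank_eq_card_of_mem_blowUp certM_mem_blowUp (by rw [hrank]; simp)
  rw [mem_NSING_iff, hnc, Fintype.card_fin]
  exact lt_irrefl 3

/-- **`NSING_{3,3} ⊊ SING_{3,3}`** (MW §10.2, p0027) — PROVED (`skewTriple`).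
[cite: MakamWigderson2021, §10.2 (p0027)] -/
theorem NSING_ssubset_SING_three : NSING 3 3 ⊂ SING 3 3 :=
  Set.ssubset_iff_subset_ne.mpr ⟨NSING_subset_SING, fun h =>
    skewTriple_not_mem_NSING (h.symm ▸ skewTriple_mem_SING)⟩

end MakamWigderson

/-! ### §1.3: the named facts (Theorems 1.12, 1.13, 1.14, 1.16; cores of 1.8/1.9; §10) -/

section Facts

open MakamWigderson

/-- **MW 2021, Thm. 1.13** (`theo:gos`, p0006:L35): "Let `S = SING_{n,m} ⊆ V = Mat_n^m`. Let `τ` denote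
the linear transformation that sends `X = (X₁,…,X_m) ↦ (X₁ᵗ,…,X_mᵗ)`. Then the group of symmetries
`𝒢_S = G_{n,m} ∪ G_{n,m} · τ = G_{n,m} ⋊ ℤ/2`." Typed in membership form (`τ = τ⁻¹`, so
`g ∈ G_{n,m}·τ ↔ gτ ∈ G_{n,m}`); the semidirect-product structure is not typed; `n, m ≥ 1`.
[cite: MakamWigderson2021, Thm. 1.13] -/
def makamWigderson2021_thm_1_13 : Prop :=
  ∀ n m : ℕ, 1 ≤ n → 1 ≤ m → ∀ g : LinearMap.GeneralLinearGroup ℂ (Tuple n m),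
    g ∈ symmetryGroup (SING n m) ↔ g ∈ G n m ∨ g * tau n m ∈ G n m

/-- **MW 2021, Thm. 1.14** (`theo:ngos`, p0006:L40): "Let `S = NSING_{n,m} ⊆ Mat_n^m`. Then the group of
symmetries `𝒢_S = G_{n,m} ⋊ ℤ/2` (as defined in the above theorem)." Membership form as for
Thm. 1.13; `NSING` in the shrunk-subspace form (module docstring); `n, m ≥ 1`.
[cite: MakamWigderson2021, Thm. 1.14] -/
def makamWigderson2021_thm_1_14 : Prop :=
  ∀ n m : ℕ, 1 ≤ n → 1 ≤ m → ∀ g : LinearMap.GeneralLinearGroup ℂ (Tuple n m),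
    g ∈ symmetryGroup (NSING n m) ↔ g ∈ G n m ∨ g * tau n m ∈ G n m

/-- **MW 2021, Thm. 1.12 (Frobenius)** (`theo:frob`, p0006:L30), the case `m = 1`: "Let
`S = SING_{n,1} ⊆ V = Mat_n`. The group of symmetries `𝒢_S` consists of linear transformations of
the form `X ↦ PXQ` or of the form `X ↦ PXᵗQ` where `P, Q ∈ SL_n`." Typed in the reading the paper
itself uses in §6 (p0015:L5: "`X ↦ PXQᵗ`, `(P,Q) ∈ GL_n × GL_n` … is the group `G_{n,1}`", and
Thm. 1.13 at `m = 1`): `𝒢_{SING_{n,1}} = G_{n,1} ∪ G_{n,1}·τ`, i.e. `P, Q ∈ GL_n`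
[Frobenius 1897; Dieudonné 1949]. ERRATUM-NOTED: read literally with "`SL_n`" the printed sentence
is false for `n ≥ 1` (`X ↦ 2X` preserves `S` and is of neither form with unimodular `P, Q`, as it
scales `det` by `2ⁿ`); the typed statement is the intended one. The tree's
`Literature.NumberTheory.DiophantineGeometry.frobenius_detPreserver_unimodular_sandwich` is the
determinant-PRESERVER form, a different theorem. [cite: MakamWigderson2021, Thm. 1.12] -/
def makamWigderson2021_thm_1_12 : Prop :=
  ∀ n : ℕ, 1 ≤ n → ∀ g : LinearMap.GeneralLinearGroup ℂ (Tuple n 1),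
    g ∈ symmetryGroup (SING n 1) ↔ g ∈ G n 1 ∨ g * tau n 1 ∈ G n 1

/-- Thm. 1.12 (as typed) is the case `m = 1` of Thm. 1.13. [cite: MakamWigderson2021, Thm. 1.12] -/
theorem makamWigderson2021_thm_1_12_of_thm_1_13 (h : makamWigderson2021_thm_1_13) :
    makamWigderson2021_thm_1_12 := fun n hn g => h n 1 hn le_rfl g

/-- The matrix of variables `Xᵢ = (x^{(i)}_{j,k})_{j,k}` over `ℂ[Mat_n^m] = ℂ[x^{(i)}_{j,k}]`
(MW §10, p0026:L29: "`x^{(i)}_{j,k}` the `(j,k)` coordinate of the `i`-th matrix").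
[cite: MakamWigderson2021, §10 (p0026:L29)] -/
def MakamWigderson.varMatrix (n m : ℕ) (i : Fin m) :
    Matrix (Fin n) (Fin n) (MvPolynomial (Fin m × Fin n × Fin n) ℂ) :=
  Matrix.of fun j k => MvPolynomial.X (i, j, k)

/-- The determinantal polynomials `det(∑ᵢ cᵢ Xᵢ) ∈ ℂ[Mat_n^m]`, `c ∈ ℂ^m` (MW §1.3, p0007:L1:
"for any `cᵢ ∈ ℂ`, the polynomial `det(∑ᵢ cᵢXᵢ)` vanishes on `SING_{n,m}`").
[cite: MakamWigderson2021, §1.3 (p0007:L1)] -/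
def MakamWigderson.detPencilPoly (n m : ℕ) (c : Fin m → ℂ) :
    MvPolynomial (Fin m × Fin n × Fin n) ℂ :=
  (∑ i, c i • MakamWigderson.varMatrix n m i).det

/-- The coordinates `x^{(i)}_{j,k}(X) = (Xᵢ)_{j,k}` of a tuple, as a point of `ℂ^{[m]×[n]×[n]}`.
[cite: MakamWigderson2021, §10 (p0026:L29)] -/
def MakamWigderson.coords {n m : ℕ} (X : Tuple n m) : Fin m × Fin n × Fin n → ℂ :=
  fun p => X p.1 p.2.1 p.2.2

/-- **The invariant ring `ℂ[V]^Γ` of a linear action** `ρ : Γ → GL(V)`, `V = Mat_n^m` (MW Def. 2.3 /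
2.4, p0008:L19–24: "`f` is invariant if `f(g v) = f(v)` for all `g`, `v`"; polynomial functions on
`V` are `MvPolynomial (Fin m × Fin n × Fin n) ℂ`, legitimately so over the infinite field `ℂ`).
[cite: MakamWigderson2021, Def. 2.4] -/
def MakamWigderson.invariantSubalgebra {n m : ℕ} {Γ : Type*} [Group Γ]
    (ρ : Γ →* LinearMap.GeneralLinearGroup ℂ (Tuple n m)) :
    Subalgebra ℂ (MvPolynomial (Fin m × Fin n × Fin n) ℂ) where
  carrier := {f | ∀ (γ : Γ) (X : Tuple n m),
    MvPolynomial.eval (coords (((ρ γ : LinearMap.GeneralLinearGroup ℂ (Tuple n m)) :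
      Tuple n m →ₗ[ℂ] Tuple n m) X)) f = MvPolynomial.eval (coords X) f}
  mul_mem' ha hb := fun γ X => by rw [map_mul, map_mul, ha γ X, hb γ X]
  add_mem' ha hb := fun γ X => by rw [map_add, map_add, ha γ X, hb γ X]
  algebraMap_mem' r := fun γ X => by rw [MvPolynomial.algebraMap_eq, eval_C, eval_C]

/-- **MW 2021, Thm. 1.16** (`theo:invring`, p0007:L3): "Suppose `n, m ≥ 3`. Then the subring
`R = ℂ[{det(∑ᵢ cᵢXᵢ) : cᵢ ∈ ℂ}] ⊆ ℂ[Mat_n^m]` is not the invariant ring for any linear action of any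
group `G` on `Mat_n^m`" (for reductive `G` a consequence of Thm. 1.8; the printed proof, §11
Prop. 11.1, works for every group). A linear action is a homomorphism `ρ : Γ →* GL(V)`.
[cite: MakamWigderson2021, Thm. 1.16] -/
def makamWigderson2021_thm_1_16 : Prop :=
  ∀ n m : ℕ, 3 ≤ n → 3 ≤ m → ∀ (Γ : Type) [Group Γ]
    (ρ : Γ →* LinearMap.GeneralLinearGroup ℂ (Tuple n m)),
    invariantSubalgebra ρ ≠ Algebra.adjoin ℂ (Set.range (detPencilPoly n m))

/-- **MW 2021, §10.2** (p0027): "`NSING_{n,m}` is a proper subset of `SING_{n,m}` precisely when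
`n, m ≥ 3`": for `n ≤ 2` or `m ≤ 2`, `SING_{n,m} = NSING_{n,m}` ([FR], [DM]: commutative = non-commutative
rank for `2 × 2` pencils; [Happel]: `det(c₁X₁ + c₂X₂)` generate the `SL_n × SL_n` invariants), and the
`3`-tuple `skewTriple` (a basis of `𝔰𝔬₃`) "is in `SING_{3,3}` but not in `NSING_{3,3}`" ([FR], [DM-ncrk]);
"for larger `n` and `m`, this example can be modified in straightforward ways". The memberships
`skewTriple ∈ SING_{3,3}`, `skewTriple ∉ NSING_{3,3}` are PROVED (`skewTriple_mem_SING`,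
`skewTriple_not_mem_NSING`, so the middle conjunct is a theorem and `NSING_ssubset_SING_three`
gives `n = m = 3`); typed: the equality for small `n` or `m` and properness for all `n, m ≥ 3`.
[cite: MakamWigderson2021, §10.2 (p0027)] -/
def makamWigderson2021_sec10_properSubset : Prop :=
  (∀ n m : ℕ, n ≤ 2 ∨ m ≤ 2 → SING n m = NSING n m) ∧
  skewTriple ∉ NSING 3 3 ∧
  ∀ n m : ℕ, 3 ≤ n → 3 ≤ m → NSING n m ⊂ SING n m

/-- **Core of MW 2021, Thm. 1.9** (`theo:nullcone2`, p0006:L1), the statement its printed proof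
(§10.2, p0026:L69–p0027:L1) establishes after the Hilbert–Mumford criterion (Thm. 2.11:
`𝒩_G = G·𝒩_T`, `𝒩_T` a union of coordinate subspaces in a weight basis, Prop. 2.10) and conjugation
of a maximal torus into `T_{n,m}`: every symmetry `g ∈ 𝒢_{SING_{n,m}}` maps every coordinate
subspace `L_I ⊆ SING_{n,m}` into `NSING_{n,m}` (Cor. 10.7: `L_I ⊆ NSING`; Thms 1.13/1.14:
`𝒢_{SING} = 𝒢_{NSING}`). Verbatim Thm. 1.9 ("Let `G` be any reductive group acting algebraically on
`V = Mat_n^m` by linear transformations which preserve `SING_{n,m}` … If the null cone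
`𝒩 ⊆ SING_{n,m}`, then `𝒩 ⊆ NSING_{n,m}`") is NOT typed: Mathlib has no reductive algebraic groups /
Hilbert–Mumford. [cite: MakamWigderson2021, Thm. 1.9 (core, via §10.2)] -/
def makamWigderson2021_thm_1_9_core : Prop :=
  ∀ (n m : ℕ) (g : LinearMap.GeneralLinearGroup ℂ (Tuple n m)), g ∈ symmetryGroup (SING n m) →
    ∀ I : Set (Fin m × Fin n × Fin n), coordSubspace I ⊆ SING n m →
      (fun X => (g : Tuple n m →ₗ[ℂ] Tuple n m) X) '' coordSubspace I ⊆ NSING n m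

/-- **Core of MW 2021, Thm. 1.8** (`theo:nullcone`, p0005:L35; printed proof p0027: "Suppose there was
a group `G` … such that the null cone is `SING_{n,m}` … `G` must preserve `SING_{n,m}` … the null
cone is contained in `NSING_{n,m}`, which is a contradiction" since `NSING_{n,m} ⊊ SING_{n,m}` for
`n, m ≥ 3`): for `n, m ≥ 3`, no union of translates `g·L_I` (`g` in a subgroup of `𝒢_{SING}`, `L_I` a
coordinate subspace inside `SING`) — the shape of a null cone by Hilbert–Mumford — equals
`SING_{n,m}`. Verbatim Thm. 1.8 ("Let `n, m ≥ 3`. Let `G` be any reductive group acting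
algebraically on `Mat_n^m` by linear transformations. Then the null cone for the action of `G` is
not equal to `SING_{n,m}`") is NOT typed (no reductive groups / Hilbert–Mumford in Mathlib).
[cite: MakamWigderson2021, Thm. 1.8 (core, via §10.2)] -/
def makamWigderson2021_thm_1_8_core : Prop :=
  ∀ n m : ℕ, 3 ≤ n → 3 ≤ m →
    ∀ Γ : Subgroup (LinearMap.GeneralLinearGroup ℂ (Tuple n m)), Γ ≤ symmetryGroup (SING n m) →
      (⋃ g ∈ Γ, ⋃ I ∈ {I : Set (Fin m × Fin n × Fin n) | coordSubspace I ⊆ SING n m},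
        (fun X => (g : Tuple n m →ₗ[ℂ] Tuple n m) X) '' coordSubspace I) ≠ SING n m

/-- **Reduction** (the printed proof of Thm. 1.9, §10.2): the core of Thm. 1.9 follows from
Thm. 1.13 and Thm. 1.14 (so `𝒢_{SING} = 𝒢_{NSING}`), with Cor. 10.7 PROVED.
[cite: MakamWigderson2021, Thm. 1.9 (proof, §10.2)] -/
theorem makamWigderson2021_thm_1_9_core_of (h13 : makamWigderson2021_thm_1_13)
    (h14 : makamWigderson2021_thm_1_14) {n m : ℕ} (hn : 1 ≤ n) (hm : 1 ≤ m) (g : LinearMap.GeneralLinearGroup ℂ (Tuple n m))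
    (hg : g ∈ symmetryGroup (SING n m)) (I : Set (Fin m × Fin n × Fin n))
    (hI : coordSubspace I ⊆ SING n m) :
    (fun X => (g : Tuple n m →ₗ[ℂ] Tuple n m) X) '' coordSubspace I ⊆ NSING n m := by
  have hgN : g ∈ symmetryGroup (NSING n m) := (h14 n m hn hm g).mpr ((h13 n m hn hm g).mp hg)
  rw [mem_symmetryGroup_iff] at hgN
  have hIN : coordSubspace I ⊆ NSING n m := (coordSubspace_subset_NSING_iff_subset_SING I).mpr hI
  calc (fun X => (g : Tuple n m →ₗ[ℂ] Tuple n m) X) '' coordSubspace I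
      ⊆ (fun X => (g : Tuple n m →ₗ[ℂ] Tuple n m) X) '' NSING n m := Set.image_mono hIN
    _ = NSING n m := hgN

/-- Degenerate sizes: the zero tuple lies in every coordinate subspace, and for `n = 0` it is not in
`SING_{0,m}` (`det` of the empty matrix is `1`). [cite: MakamWigderson2021, Def. 10.4] -/
theorem MakamWigderson.not_coordSubspace_subset_SING_zero {m : ℕ} (I : Set (Fin m × Fin 0 × Fin 0)) :
    ¬ coordSubspace I ⊆ SING 0 m := by
  intro h
  have h0 : (0 : Tuple 0 m) ∈ coordSubspace I := fun i j k hne => absurd rfl hne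
  have h1 := (mem_SING_iff _).mp (h h0)
  rw [Matrix.det_isEmpty] at h1
  exact one_ne_zero h1

/-- Degenerate sizes: for `m = 0` and `n ≥ 1` every (empty) tuple is in `NSING_{n,0}` (the empty
matrix space has non-commutative rank `0`). [cite: MakamWigderson2021, §1.2 (NSING)] -/
theorem MakamWigderson.mem_NSING_of_m_eq_zero {n : ℕ} (hn : 1 ≤ n) (X : Tuple n 0) : X ∈ NSING n 0 := by
  rw [mem_NSING_iff]
  have hempty : Set.range X = ∅ := Set.range_eq_empty X
  have hle := ncRank_le_of_cover (Set.range X) (⊥ : Submodule ℂ (Fin n → ℂ)) ⊤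
    (fun B hB => by rw [hempty] at hB; exact absurd hB (Set.notMem_empty B))
  have hq := Submodule.finrank_quotient_add_finrank (⊤ : Submodule ℂ (Fin n → ℂ))
  rw [finrank_top] at hq
  rw [finrank_bot] at hle
  omega

/-- **`Thm. 1.13 ∧ Thm. 1.14 ⇒ Thm. 1.9 (core)`, concluding the typed fact by name** (the degenerate
sizes `n = 0` / `m = 0` are vacuous resp. trivial; for `n, m ≥ 1` this is
`makamWigderson2021_thm_1_9_core_of`). [cite: MakamWigderson2021, Thm. 1.9 (proof, §10.2)] -/
theorem makamWigderson2021_thm_1_9_core_of_thm_1_13_of_thm_1_14 (h13 : makamWigderson2021_thm_1_13)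
    (h14 : makamWigderson2021_thm_1_14) : makamWigderson2021_thm_1_9_core := by
  intro n m g hg I hI
  rcases Nat.eq_zero_or_pos n with rfl | hn
  · exact absurd hI (not_coordSubspace_subset_SING_zero I)
  rcases Nat.eq_zero_or_pos m with rfl | hm
  · intro Y _
    exact mem_NSING_of_m_eq_zero hn Y
  exact makamWigderson2021_thm_1_9_core_of h13 h14 hn hm g hg I hI

/-- **Reduction** (the printed proof of Thm. 1.8, p0027): the core of Thm. 1.8 follows from the core
of Thm. 1.9 and `NSING_{n,m} ⊊ SING_{n,m}` (`n, m ≥ 3`).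
[cite: MakamWigderson2021, Thm. 1.8 (proof, §10.2)] -/
theorem makamWigderson2021_thm_1_8_core_of (h19 : makamWigderson2021_thm_1_9_core)
    (hproper : makamWigderson2021_sec10_properSubset) : makamWigderson2021_thm_1_8_core := by
  intro n m hn hm Γ hΓ hEq
  have hsub : (⋃ g ∈ Γ, ⋃ I ∈ {I : Set (Fin m × Fin n × Fin n) | coordSubspace I ⊆ SING n m},
      (fun X => (g : Tuple n m →ₗ[ℂ] Tuple n m) X) '' coordSubspace I) ⊆ NSING n m := by
    refine Set.iUnion₂_subset fun g hg => Set.iUnion₂_subset fun I hI => ?_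
    exact h19 n m g (hΓ hg) I hI
  rw [hEq] at hsub
  exact (hproper.2.2 n m hn hm).ne (Set.Subset.antisymm NSING_subset_SING hsub)

/-- **`Thm. 1.13 ∧ Thm. 1.14 ∧ (NSING ⊊ SING for n, m ≥ 3) ⇒ Thm. 1.8 (core)`** by name.
[cite: MakamWigderson2021, Thm. 1.8 (proof, §10.2)] -/
theorem makamWigderson2021_thm_1_8_core_of_thm_1_13_of_thm_1_14 (h13 : makamWigderson2021_thm_1_13)
    (h14 : makamWigderson2021_thm_1_14) (hproper : makamWigderson2021_sec10_properSubset) :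
    makamWigderson2021_thm_1_8_core :=
  makamWigderson2021_thm_1_8_core_of
    (makamWigderson2021_thm_1_9_core_of_thm_1_13_of_thm_1_14 h13 h14) hproper

end Facts

end Literature.Computability.AlgebraicComplexity

end
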